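import Mathlib
import Literature.AlgebraicGeometry.Resolution.AdicQuotient
import Literature.AlgebraicGeometry.Resolution.AlterationsSemiStableCodimTwoBlowupFibreModels
import HarnessLib

/-!
# `TeissierResolve`, line Sketch — stub `stub_toricCompletion` (the completed simplicial toric
# ring is the completed local ring of the toric variety at its cone point)

Crux `stmt-ResolutionOfSingularities-17086`
(`Summit.ResolutionOfSingularities.ResolutionOfSingularities.Theses.TeissierJung.TeissierResolve`),
line "toric normalisation + destackification". This file proves the plumbing stub
`stub_toricCompletion` of the lead skeleton (`Cruxes/TeissierResolve/Lines/Sketch.lean`, v3).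

## Informal statement

Let `k` be a field, `A` a finite abelian group, `deg : {1, …, d} → A` weights, and grade
`S = k[y₁, …, y_d]` by `A` through `deg` (Mathlib's `MvPolynomial.weightedHomogeneousSubmodule`,
a `GradedAlgebra` via the local instance `MvPolynomial.weightedGradedAlgebra`). Let `S₀ ⊆ S` be the
degree-`0` part (the simplicial toric ring `k[σ^∨ ∩ M]`, i.e. the invariants of the diagonalizable
group `D(A)` acting on affine `d`-space) and `𝔪₀ = ker (constantCoeff|_{S₀})` its irrelevant
ideal. Then there is a point `t` of the toric variety `T = Spec S₀` — the cone point `t = 𝔪₀` —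
and a ring isomorphism
`E : (S₀)^_{𝔪₀} ≅ 𝒪̂_{T,t}` (`AdicCompletion 𝔪₀ S₀ ≃+* AdicCompletion 𝔪_{T,t} 𝒪_{T,t}`)
compatible with the two `k`-structures: for `a ∈ k`, `E` maps the image of `a` in `(S₀)^` to the
image in `𝒪̂_{T,t}` of the germ at `t` of the global section `a` of `T → Spec k`.

## Proof

* `𝔪₀` is a maximal ideal: `constantCoeff ∘ (S₀ ↪ S) : S₀ → k` is onto (the constants `C a`
  have weighted degree `0`), so its kernel is maximal (`RingHom.ker_isMaximal_of_surjective`);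
  `t := 𝔪₀ ∈ Spec S₀`.
* The stalk `𝒪_{T,t}` is a localization of `S₀` at `𝔪₀` (Mathlib:
  `StructureSheaf.IsLocalization.to_stalk`, for the algebra structure `StructureSheaf.stalkAlgebra`
  given by `toStalk`), so the tree's `adicCompletionEquivOfIsLocalizationAtMaximal`
  (`AlterationsSemiStableCodimTwoBlowupFibreModels.lean`: the `𝔭`-adic completion of `R` at a
  maximal ideal `𝔭` is the completion of ANY localization of `R` at `𝔭`, because the levels
  `R/𝔭ⁿ → R_𝔭/𝔭ⁿR_𝔭` are bijective — Atiyah–Macdonald Prop. 10.15–10.16 / Stacks 05GG) is the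
  required `E`; it extends `S₀ → 𝒪_{T,t}` (`adicCompletionEquivOfIsLocalizationAtMaximal_of`).
* Compatibility with `k`: by naturality of `ΓSpecIso` (`Scheme.ΓSpecIso_inv_naturality`) the
  global section `(Spec (k → S₀))^* a` of `T` is the global section `algebraMap k S₀ a`, whose germ
  at `t` is `toStalk S₀ t (algebraMap k S₀ a) = algebraMap S₀ 𝒪_{T,t} (algebraMap k S₀ a)`
  (definitionally: `ΓSpecIso_inv`, `StructureSheaf.toStalk`); both sides are then
  `AdicCompletion.of (algebraMap S₀ 𝒪_{T,t} (algebraMap k S₀ a))`.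

Sources: M. F. Atiyah, I. G. Macdonald, *Introduction to Commutative Algebra* (1969),
Prop. 10.15–10.16 (completion at a maximal ideal vs. localization); The Stacks Project, Tag 05GG;
W. Fulton, *Introduction to Toric Varieties* (1993), §2.1–2.2 (simplicial cones and quotient
singularities) for the terminology. No new definitions, no named facts. [folklore]
-/

noncomputable section

set_option linter.dupNamespace false -- mandated namespace of this single-conjunct summit

open CategoryTheory AlgebraicGeometry TopologicalSpace IsLocalRing
open Literature.AlgebraicGeometry.Resolution

namespace Summit.ResolutionOfSingularities.ResolutionOfSingularities.Theorems.TeissierResolve.ToricCompletion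

attribute [local instance] MvPolynomial.weightedGradedAlgebra

/-- The augmentation `constantCoeff ∘ (S₀ ↪ k[y])` of the degree-`0` part `S₀` of a weighted
polynomial ring is onto `k`: the constants have weighted degree `0`. [folklore] -/
theorem constantCoeff_comp_algebraMap_surjective (k : Type) [Field k] (d : ℕ) (A : Type)
    [AddCommGroup A] [DecidableEq A] (deg : Fin d → A) :
    Function.Surjective (MvPolynomial.constantCoeff.comp
      (algebraMap (MvPolynomial.weightedHomogeneousSubmodule k deg 0) (MvPolynomial (Fin d) k))) :=
  fun a => ⟨algebraMap k (MvPolynomial.weightedHomogeneousSubmodule k deg 0) a, by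
    rw [RingHom.comp_apply, SetLike.GradeZero.algebraMap_apply, SetLike.GradeZero.coe_algebraMap,
      MvPolynomial.algebraMap_eq, MvPolynomial.constantCoeff_C]⟩

/-- The irrelevant ideal `𝔪₀ = ker (constantCoeff ∘ (S₀ ↪ k[y]))` of the degree-`0` part `S₀` of
a weighted polynomial ring over a field is maximal (`S₀ ⧸ 𝔪₀ ≅ k`). [folklore] -/
theorem ker_constantCoeff_comp_algebraMap_isMaximal (k : Type) [Field k] (d : ℕ) (A : Type)
    [AddCommGroup A] [DecidableEq A] (deg : Fin d → A) :
    (RingHom.ker (MvPolynomial.constantCoeff.comp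
      (algebraMap (MvPolynomial.weightedHomogeneousSubmodule k deg 0)
        (MvPolynomial (Fin d) k)))).IsMaximal :=
  RingHom.ker_isMaximal_of_surjective _ (constantCoeff_comp_algebraMap_surjective k d A deg)

/-- On `Spec R`, the germ at `t` of the global section attached to `r ∈ R` (through `ΓSpecIso`)
is the image of `r` under the structure map `R → 𝒪_{Spec R, t}` of the stalk
(`StructureSheaf.stalkAlgebra`, i.e. `StructureSheaf.toStalk`) — definitionally. [folklore] -/
theorem germ_ΓSpecIso_inv_apply (R : Type) [CommRing R] (t : Spec (.of R)) (r : R) :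
    letI : Algebra R ((Spec (.of R)).presheaf.stalk t) := StructureSheaf.stalkAlgebra R t
    ((Spec (.of R)).presheaf.germ ⊤ t trivial).hom ((Scheme.ΓSpecIso (.of R)).inv.hom r) =
      algebraMap R ((Spec (.of R)).presheaf.stalk t) r :=
  rfl

/-- On `Spec R`, for a ring map `φ : K → R`, the germ at `t` of the pulled-back global section
`(Spec φ)^* a`, `a ∈ K = Γ(Spec K)`, is the image of `φ a` under the structure map
`R → 𝒪_{Spec R, t}` (`ΓSpecIso` naturality + `germ_ΓSpecIso_inv_apply`). [folklore] -/
theorem germ_appTop_ΓSpecIso_inv_apply (K R : Type) [CommRing K] [CommRing R] (φ : K →+* R)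
    (t : Spec (.of R)) (a : K) :
    letI : Algebra R ((Spec (.of R)).presheaf.stalk t) := StructureSheaf.stalkAlgebra R t
    ((Spec (.of R)).presheaf.germ ⊤ t trivial).hom
        ((Spec.map (CommRingCat.ofHom φ)).appTop.hom ((Scheme.ΓSpecIso (.of K)).inv.hom a)) =
      algebraMap R ((Spec (.of R)).presheaf.stalk t) (φ a) := by
  have h := congrArg (fun f => f.hom a) (Scheme.ΓSpecIso_inv_naturality (CommRingCat.ofHom φ))
  simp only [CommRingCat.hom_comp, RingHom.comp_apply, CommRingCat.hom_ofHom] at h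
  rw [← h]
  rfl

/-- **The completed simplicial toric ring is the completed local ring of the toric variety at
its cone point, compatibly with `k`.** For a field `k`, a finite abelian group `A`, weights
`deg : Fin d → A` and `S₀ = (k[y₁, …, y_d])₀` the degree-`0` part of the weighted grading
(`MvPolynomial.weightedHomogeneousSubmodule k deg 0`) with irrelevant ideal
`𝔪₀ = ker (constantCoeff ∘ (S₀ ↪ k[y]))`: there are a point `t` of `T = Spec S₀` (namely
`t = 𝔪₀`, a maximal ideal) and a ring isomorphism `AdicCompletion 𝔪₀ S₀ ≃+* 𝒪̂_{T,t}`
(completion at a maximal ideal commutes with localization: the stalk is a localization of `S₀` at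
`𝔪₀`, `StructureSheaf.IsLocalization.to_stalk`, and `adicCompletionEquivOfIsLocalizationAtMaximal`)
under which, for every `a ∈ k`, the image of `a` in `(S₀)^` goes to the image in `𝒪̂_{T,t}` of
the germ at `t` of the global section `a` pulled back along `T → Spec k`. [folklore] -/
theorem stub_toricCompletion (k : Type) [Field k] (d : ℕ) (A : Type) [AddCommGroup A] [Finite A]
    [DecidableEq A] (deg : Fin d → A) :
    ∃ (t : Spec (.of (MvPolynomial.weightedHomogeneousSubmodule k deg 0)))
      (E : AdicCompletion
            (RingHom.ker (MvPolynomial.constantCoeff.comp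
              (algebraMap (MvPolynomial.weightedHomogeneousSubmodule k deg 0)
                (MvPolynomial (Fin d) k))))
            (MvPolynomial.weightedHomogeneousSubmodule k deg 0) ≃+*
          AdicCompletion
            (maximalIdeal ((Spec (.of (MvPolynomial.weightedHomogeneousSubmodule k deg 0))).presheaf.stalk t))
            ((Spec (.of (MvPolynomial.weightedHomogeneousSubmodule k deg 0))).presheaf.stalk t)),
      ∀ a : k,
        E (algebraMap (MvPolynomial.weightedHomogeneousSubmodule k deg 0) _
            (algebraMap k (MvPolynomial.weightedHomogeneousSubmodule k deg 0) a)) =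
          algebraMap _ _
            (((Spec (.of (MvPolynomial.weightedHomogeneousSubmodule k deg 0))).presheaf.germ ⊤ t
                trivial).hom
              ((Spec.map (CommRingCat.ofHom
                  (algebraMap k (MvPolynomial.weightedHomogeneousSubmodule k deg 0)))).appTop.hom
                ((Scheme.ΓSpecIso (.of k)).inv.hom a))) := by
  -- the simplicial toric ring `S₀ = k[y]₀` and its irrelevant ideal `𝔪₀`, a maximal ideal
  set S₀ := MvPolynomial.weightedHomogeneousSubmodule k deg 0
  set 𝔪₀ : Ideal S₀ := RingHom.ker (MvPolynomial.constantCoeff.comp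
      (algebraMap S₀ (MvPolynomial (Fin d) k)))
  haveI hmax : 𝔪₀.IsMaximal := ker_constantCoeff_comp_algebraMap_isMaximal k d A deg
  -- the cone point `t = 𝔪₀` of `T = Spec S₀`; its stalk is a localization of `S₀` at `𝔪₀`
  let t : Spec (.of S₀) := ⟨𝔪₀, hmax.isPrime⟩
  letI : Algebra S₀ ((Spec (.of S₀)).presheaf.stalk t) := StructureSheaf.stalkAlgebra S₀ t
  haveI : IsLocalization.AtPrime ((Spec (.of S₀)).presheaf.stalk t) 𝔪₀ :=
    StructureSheaf.IsLocalization.to_stalk S₀ t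
  -- completion at the maximal ideal `𝔪₀` commutes with localization at `𝔪₀`
  refine ⟨t, adicCompletionEquivOfIsLocalizationAtMaximal 𝔪₀ ((Spec (.of S₀)).presheaf.stalk t),
    fun a => ?_⟩
  -- compatibility with `k`: both sides are `AdicCompletion.of (algebraMap S₀ 𝒪_{T,t} (a : S₀))`
  rw [germ_appTop_ΓSpecIso_inv_apply, AdicCompletion.algebraMap_apply, Algebra.algebraMap_self,
    RingHom.id_apply, adicCompletionEquivOfIsLocalizationAtMaximal_of,
    AdicCompletion.algebraMap_apply, Algebra.algebraMap_self, RingHom.id_apply]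

end Summit.ResolutionOfSingularities.ResolutionOfSingularities.Theorems.TeissierResolve.ToricCompletion

end
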